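import Literature.AlgebraicGeometry.Frobenioids.PadicFrobenioidBasePushIsoAbs
import Literature.AlgebraicGeometry.Frobenioids.PadicFrobenioidPairIsoExposed
import Literature.AlgebraicGeometry.Frobenioids.PadicFrobenioidPairIsoUnitsTransport
import Literature.AlgebraicGeometry.Frobenioids.PadicKummerIsoGInnerTwist
import Literature.AlgebraicGeometry.Frobenioids.PadicKummerThm24iFrobenioidRelOfEquivalence
import Literature.AlgebraicGeometry.Frobenioids.ModelFrobenioidPsiBEffective
import Literature.AlgebraicGeometry.Frobenioids.PadicKummerThm24iiGalois
import Literature.AnabelianGeometry.AbsoluteAnabelian.AbsAnabUnitsTransportInnerTwist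
import HarnessLib

/-!
# Frobenioids II, Theorem 2.4 (i)+(ii) for an equivalence `Ψ` of `p`-adic Frobenioids over the absolute bases `𝓑^temp(Πᵢ)⁰`:
# ONE context isomorphism `e` whose `G₁ ⥲ G₂` IS the representative over which `Ψ`'s `K̄₁^× ⥲ K̄₂^×` is the [AbsAnab]
# units transport — (ii) modulo the `μ_N`-square "`Ψ` on `μ_N(A₁)` IS that transport"

Mochizuki, *The geometry of Frobenioids II*, Kyushu J. Math. **62** (2008) 401–460, §2, Theorem 2.4 pp. 19–21
[cite: MochizukiFrdII2008, Thm 2.4 (i) p.19] "an equivalence of categories `Ψ : C₁ ⥲ C₂` … induces a 1-compatible equivalence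
`Ψ_Base : D₁ ⥲ D₂`, hence an outer isomorphism of topological groups `Π₁ ⥲ Π₂` … that lies over an outer isomorphism `G₁ ⥲ G₂`.
Assume that this isomorphism `G₁ ⥲ G₂` maps `H₁` onto `H₂`. Then: (i) … (ii) … compatible with the natural isomorphisms
`F_N(Aᵢ) ⥲ ℤ/Nℤ`"; proof of (ii) p. 21 [cite: MochizukiFrdII2008, Thm 2.4 (ii) p.21]: "`Ψ` induces a pair of compatible
isomorphisms `G₁ ⥲ G₂`; `K̄₁^× ⥲ K̄₂^×` … we may apply [[AbsAnab], Prop. 1.2.1]".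

PROOF-ONLY assembly (cell abc-iut, node FrdII:Thm2.4(ii), junction «T24ii-J2» piece P5b; seat abc-iut-L1-t7 gen 8) of
* abc-iut-w5-d229's Frobenioid side (`PadicFrobenioidPairIsoLevelwise`/`Orientation`, re-run with every witness of ONE run in
  scope: `PadicFrobenioidPairIsoExposed`) — `φ : Π₁ ⥲ Π₂` read off a straightening `ι`, its descent `ψ : G₁ ⥲ G₂`, the pair
  `ψ̄ : ℚ̄_{p₁}^× ⥲ ℚ̄_{p₂}^×` levelwise "`toB0₂ ∘ Ψ_B ∘ toB0₁⁻¹`", oriented by "`Ψ_B` preserves effective divisors" (abc-iut-L1-d3's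
  `hpos_of_equivalence`, from "`Ψ` preserves `O^▷`" = [FrdI] Thm. 3.4 (iv) PROVED + the `Ψ_B`-hypothesis `hΨB`), and its [AbsAnab]
  chart `(α, ψ̄♮)` = THE units transport of [AbsAnab] Prop. 1.2.1;
* abc-iut-L1-t7's Kummer side (`PadicKummerThm24iFrobenioidRelBase.isoOfFunctorRelBasePush` over `Dᵢ.relTop`, F1
  `PadicFrobenioidRelTop`) AT `θ := φ` — possible by `PadicFrobenioidBasePushIsoAbs.exists_basePushIso_relTop` (`φ_* ≅ Ψ_Base`
  naturally for THIS `φ`) — whose representative `isoGOfTheta` of `G₁ ⥲ G₂` is `Inn(δ⁻¹) ∘ α` (gen 7's `isoGOfTheta_eq_innerTwist'`),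
  so that `δ⁻¹ • ψ̄♮` is `isoG`-equivariant, `𝒪^×`- and uniformiser-preserving (gen 7's `AbsAnabUnitsTransportInnerTwist`).
Result `exists_thm24_ofEquivalenceAbs`: for `(N, Hᵢ)`-saturated objects with `μ_N(K̄ᵢ) ⊆ Lᵢ`, there are a representative `β` of
the outer isomorphism `G₁ ⥲ G₂` and `ψ̄ : K̄₁^× ⥲ K̄₂^×` with the three [AbsAnab] properties such that, ASSUMING "this isomorphism
maps `H₁` onto `H₂`" (print's hypothesis, stated for `β`), THE `Ψ`-induced isomorphism `e` of Definition-2.2 contexts has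
`e.isoG = β`, `e` on `Aut` IS `Ψ`, Theorem 2.4 (i) holds for `e` (gen 6's `thm24i_ofFunctorRel_ofBasePush`), AND Theorem 2.4 (ii)
holds for `e` and the invariants pinned to the local-class-field-theory residue maps (abc-iut-w5-d201/L2-t12's closer
`exists_thm24ii_ofGalois`) AS SOON AS the `μ_N`-square "`e.muIso` IS `ψ̄` on `μ_N(A₁)`" holds — the one remaining input,
delivered separately (abc-iut-L1-d1's `hO_of_levelwise`, piece P5a).  Hypothesis binders BY NAME: `E`+`η` ("`Ψ` induces a
1-compatible `Ψ_Base`", [FrdI] Thm. 3.4 (v)), `Ψ_B`+`hΨB` ([FrdI] Cor. 4.10/4.11 (ii), abc-iut-L1-d3 discharging), temp-slim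
tempered `Πᵢ`, fieldwise saturation of both data, the layers `Eᵢ`.  Theorems only; nothing here bears on [IUTchIII] Cor. 3.12;
(Filed by abc-iut-E-t32 g8 by adoption, abc-iut-L1-lead R150; mathematics and text by abc-iut-L1-t7 g8, staged 21:58:56Z, MANIFEST 72741bd63407a5d1.)
typed ≠ proved for the `μ_N`-square.
-/

noncomputable section

namespace Literature.AlgebraicGeometry.Frobenioids

namespace PadicKummer.Def22Context

open CategoryTheory CategoryTheory.Limits Opposite Topology Filter Field IntermediateField Kummer Function
open Literature.NumberTheory.GaloisRepresentations
open Literature.NumberTheory.GaloisRepresentations.LocalWeilDatum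
open Literature.NumberTheory.GaloisRepresentations.DiscreteGaloisModule
open Literature.AnabelianGeometry.SemiGraphs QuasiTemperoid PadicFrd PadicFrd.Datum PadicFrd.Datum.GaloisChart PadicFrd.RelGal
open Literature.AnabelianGeometry.AbsoluteAnabelian BaseGaloisSystem

variable {p₁ p₂ : ℕ} [Fact p₁.Prime] [Fact p₂.Prime]
  {P₁ : Type} [Group P₁] [TopologicalSpace P₁] [IsTopologicalGroup P₁] [SecondCountableTopology P₁] (hP₁ : IsTempered P₁)
  (hZ₁ : IsSlimGroup P₁) {φ₁ : P₁ →* GalFbar ℚ_[p₁]} {hφ₁ : IsOpenHom φ₁}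
  {d₁ : PadicFrd.Datum (CosetCat P₁) p₁}
  (hd₁ : d₁.base = CosetCat.push φ₁ hφ₁.isOpenMap ⋙ CosetCat.toConnected (isTempered_galFbar ℚ_[p₁]) ⋙ galoisPadicFields p₁)
  {P₂ : Type} [Group P₂] [TopologicalSpace P₂] [IsTopologicalGroup P₂] (hP₂ : IsTempered P₂) (hZ₂ : IsSlimGroup P₂)
  {φ₂ : P₂ →* GalFbar ℚ_[p₂]} {hφ₂ : IsOpenHom φ₂}
  {d₂ : PadicFrd.Datum (CosetCat P₂) p₂}
  (hd₂ : d₂.base = CosetCat.push φ₂ hφ₂.isOpenMap ⋙ CosetCat.toConnected (isTempered_galFbar ℚ_[p₂]) ⋙ galoisPadicFields p₂)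
  (hfs₁ : d₁.IsFieldwiseSaturated) (hfs₂ : d₂.IsFieldwiseSaturated)
  (Ψ : d₁.frobenioid ≌ d₂.frobenioid) (E : CosetCat P₁ ≌ CosetCat P₂)
  (η : Ψ.functor ⋙ ModelFrobenioid.baseFunctor d₂.Φ d₂.B d₂.divB ≅ ModelFrobenioid.baseFunctor d₁.Φ d₁.B d₁.divB ⋙ E.functor)
  (ΨB : d₁.B ≅ E.functor.op ⋙ d₂.B)
  (hΨB : ∀ (A : d₁.frobenioid) (f : A ⟶ A), f ∈ PreFrobenioid.endSubmonoid d₁.structureFunctor A →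
    ModelFrobenioid.unit (Ψ.functor.map f) =
      (d₂.B.map (η.hom.app A).op).hom (ΨB.hom.app (op A.base) (ModelFrobenioid.unit f)))
  {A₁ : d₁.frobenioid} (hA₁ : A₁.base.sg.toSubgroup.Normal) (hA₂ : (Ψ.functor.obj A₁).base.sg.toSubgroup.Normal)
  {H₁ : Subgroup (absoluteGaloisGroup (baseFld p₁ φ₁ hφ₁))} [H₁.Normal]
  {hH₁ : IsOpen (H₁ : Set (absoluteGaloisGroup (baseFld p₁ φ₁ hφ₁)))}
  {H₂ : Subgroup (absoluteGaloisGroup (baseFld p₂ φ₂ hφ₂))} [H₂.Normal]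
  {hH₂ : IsOpen (H₂ : Set (absoluteGaloisGroup (baseFld p₂ φ₂ hφ₂)))}
  (M : ℕ) [NeZero M]
  (hμ₁ : ∀ ζ : rootsOfUnity M (AlgebraicClosure (baseFld p₁ φ₁ hφ₁)),
    ((ζ : (AlgebraicClosure (baseFld p₁ φ₁ hφ₁))ˣ) : AlgebraicClosure (baseFld p₁ φ₁ hφ₁)) ∈
      objL φ₁ hφ₁ d₁.relTop (d₁.toRelTopFrob.obj A₁))
  (hμ₂ : ∀ ζ : rootsOfUnity M (AlgebraicClosure (baseFld p₂ φ₂ hφ₂)),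
    ((ζ : (AlgebraicClosure (baseFld p₂ φ₂ hφ₂))ˣ) : AlgebraicClosure (baseFld p₂ φ₂ hφ₂)) ∈
      objL φ₂ hφ₂ d₂.relTop (d₂.toRelTopFrob.obj (Ψ.functor.obj A₁)))
  (hc₁ : IsNHSaturated (contextOfObjectAbs φ₁ hφ₁ d₁ hd₁ A₁ hA₁ H₁ hH₁) M)
  (E₁ : Type) [Field E₁] [Algebra (baseFld p₁ φ₁ hφ₁) E₁] [FiniteDimensional (baseFld p₁ φ₁ hφ₁) E₁]
  [Finite (MuCarrier E₁ M)] (hHE₁ : H₁ = galFixing (baseFld p₁ φ₁ hφ₁) (embField (baseFld p₁ φ₁ hφ₁) E₁))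
  (E₂ : Type) [Field E₂] [Algebra (baseFld p₂ φ₂ hφ₂) E₂] [FiniteDimensional (baseFld p₂ φ₂ hφ₂) E₂]
  [Finite (MuCarrier E₂ M)] (hHE₂ : H₂ = galFixing (baseFld p₂ φ₂ hφ₂) (embField (baseFld p₂ φ₂ hφ₂) E₂))

include hP₁ hZ₁ hP₂ hZ₂ hfs₁ hfs₂ η hΨB in
/-- **[FrdII] Theorem 2.4 (i)+(ii) for an EQUIVALENCE `Ψ : C₁ ⥲ C₂` of `p`-adic Frobenioids over the absolute genuine bases
`𝓑^temp(Πᵢ)⁰` (`Πᵢ` temp-slim tempered, `Π₁` Galois-countable), at `(N, Hᵢ)`-saturated objects `A₁`, `Ψ A₁` with Galois bases and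
`μ_N(K̄ᵢ) ⊆ Lᵢ` — ONE representative, (ii) modulo the `μ_N`-square.**  With the printed inputs BY NAME — a 1-compatible base
equivalence `E`, `η` ([FrdI] Thm. 3.4 (v)), the row-L02 slot `Ψ_B` with "`u_{Ψ f} = η^* Ψ_B(u_f)` on `O^▷`" ([FrdI] Cor. 4.10/4.11
(ii)), fieldwise saturation, the layers `Eᵢ` (`Hᵢ = G_{Eᵢ}`) — there are `β : G_{K₁} ⥲ G_{K₂}` (a representative of the outer
isomorphism "that lies over" `Π₁ ⥲ Π₂`) and `ψ̄ : K̄₁^× ⥲ K̄₂^×` which is `β`-equivariant, carries `𝒪^×` onto `𝒪^×` and uniformisers to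
uniformisers (THE units transport of [AbsAnab] Prop. 1.2.1 for `β` — it is `δ⁻¹ • ψ̄♮` for `Ψ`'s pair read in the chart), such
that UNDER "this isomorphism `G₁ ⥲ G₂` maps `H₁` onto `H₂`" (`map_H`, for `β`): the `Ψ`-induced isomorphism `e` of the
Definition-2.2 contexts of `A₁`, `Ψ A₁` (gen 6's `isoOfFunctorRelBasePush` at `θ := φ`) has `e.isoG = β` and `e` on `Aut_C` equal
to `Ψ`; (i) `Thm24i` holds for `e`'s comparison data and the cup-product duality isomorphisms (given `hfs`, any normalisation
`F_N(A₁) ≅ ℤ/N`); and (ii) IF "`e.muIso` IS `ψ̄` on `μ_N(A₁)`" through the charts' `μ`-models (the `μ_N`-square, piece P5a), then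
the invariants `invᵢ = inv_{Eᵢ} ∘ Θᵢ : F_N(Aᵢ) ⥲ ℤ/Nℤ` pinned to the local-class-field-theory residue maps EXIST and
`Thm24ii … (e.thm24Data N) inv₁ inv₂`. [cite: MochizukiFrdII2008, Thm 2.4 (ii) p.20] -/
theorem exists_thm24_ofEquivalenceAbs (fs₁ fs₂ : Prop) :
    letI := PadicAlgCl.subfieldValuativeRel (baseFld p₁ φ₁ hφ₁)
    letI := PadicAlgCl.subfieldValuativeRel (baseFld p₂ φ₂ hφ₂)
    haveI := finiteDimensional_baseFld p₁ φ₁ hφ₁; haveI := finiteDimensional_baseFld p₂ φ₂ hφ₂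
    haveI := PadicAlgCl.isNonarchimedeanLocalField_subfield (baseFld p₁ φ₁ hφ₁)
    haveI := PadicAlgCl.isNonarchimedeanLocalField_subfield (baseFld p₂ φ₂ hφ₂)
    haveI := finiteDimensional_objL φ₁ hφ₁ d₁.relTop (d₁.toRelTopFrob.obj A₁)
    haveI := normal_objL φ₁ hφ₁ d₁.relTop (d₁.toRelTopFrob.obj A₁) hA₁
    haveI := finiteDimensional_objL φ₂ hφ₂ d₂.relTop (d₂.toRelTopFrob.obj (Ψ.functor.obj A₁))
    haveI := normal_objL φ₂ hφ₂ d₂.relTop (d₂.toRelTopFrob.obj (Ψ.functor.obj A₁)) hA₂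
    haveI := locallyCompactSpace_H_contextOfObjectRel φ₁ hφ₁ d₁.relTop (d₁.relTop_base_eq φ₁ hφ₁ hd₁)
      (d₁.toRelTopFrob.obj A₁) hA₁ H₁ hH₁
    haveI := locallyCompactSpace_H_contextOfObjectRel φ₂ hφ₂ d₂.relTop (d₂.relTop_base_eq φ₂ hφ₂ hd₂)
      (d₂.toRelTopFrob.obj (Ψ.functor.obj A₁)) hA₂ H₂ hH₂
    letI := (galoisChartRel φ₁ hφ₁ d₁.relTop (d₁.relTop_base_eq φ₁ hφ₁ hd₁) (d₁.toRelTopFrob.obj A₁) hA₁).galAction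
    letI := (galoisChartRel φ₂ hφ₂ d₂.relTop (d₂.relTop_base_eq φ₂ hφ₂ hd₂)
      (d₂.toRelTopFrob.obj (Ψ.functor.obj A₁)) hA₂).galAction
    letI := FiniteExtension.valuativeRel (baseFld p₁ φ₁ hφ₁) E₁
    letI := FiniteExtension.topologicalSpace (baseFld p₁ φ₁ hφ₁) E₁
    haveI := FiniteExtension.isNonarchimedeanLocalField (baseFld p₁ φ₁ hφ₁) E₁
    letI := FiniteExtension.valuativeRel (baseFld p₂ φ₂ hφ₂) E₂
    letI := FiniteExtension.topologicalSpace (baseFld p₂ φ₂ hφ₂) E₂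
    haveI := FiniteExtension.isNonarchimedeanLocalField (baseFld p₂ φ₂ hφ₂) E₂
    ∃ (β : absoluteGaloisGroup (baseFld p₁ φ₁ hφ₁) ≃ₜ* absoluteGaloisGroup (baseFld p₂ φ₂ hφ₂))
      (ψbar : (AlgebraicClosure (baseFld p₁ φ₁ hφ₁))ˣ ≃* (AlgebraicClosure (baseFld p₂ φ₂ hφ₂))ˣ),
      Prop121vii.IsAlphaEquivariant β ψbar ∧ Prop121vii.PreservesAbsUnits ψbar ∧ Prop121vii.PreservesUniformizers ψbar ∧
      ∀ map_H : H₁.map β.toMulEquiv.toMonoidHom = H₂,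
        ∃ e : (contextOfObjectAbs φ₁ hφ₁ d₁ hd₁ A₁ hA₁ H₁ hH₁).Iso
            (contextOfObjectAbs φ₂ hφ₂ d₂ hd₂ (Ψ.functor.obj A₁) hA₂ H₂ hH₂),
          -- `e.isoG` IS `β`, and `e` on `Aut_C` IS `Ψ`
          e.isoG = β ∧
          (∀ a : Aut (d₁.toRelTopFrob.obj A₁), (e.isoC a).hom = d₂.toRelTopFrob.map (Ψ.functor.map (d₁.ofRelTopFrob.map a.hom))) ∧
          -- Theorem 2.4 (i) for `e`
          (∀ (_ : fs₁ ↔ fs₂) (eFN₁ : FN (contextOfObjectAbs φ₁ hφ₁ d₁ hd₁ A₁ hA₁ H₁ hH₁) M ≃+ ZMod M),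
            Thm24i (contextOfObjectAbs φ₁ hφ₁ d₁ hd₁ A₁ hA₁ H₁ hH₁)
              (contextOfObjectAbs φ₂ hφ₂ d₂ hd₂ (Ψ.functor.obj A₁) hA₂ H₂ hH₂) M p₁ p₂ fs₁ fs₂ (e.thm24Data M)
              ((contextOfObjectAbs φ₁ hφ₁ d₁ hd₁ A₁ hA₁ H₁ hH₁).dualityIsoOfLocalDuality M eFN₁ hc₁
                (cupDualH_bijective_ofGalois_mlf p₁ (objL φ₁ hφ₁ d₁.relTop (d₁.toRelTopFrob.obj A₁)) H₁ hH₁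
                  (galoisChartRel φ₁ hφ₁ d₁.relTop (d₁.relTop_base_eq φ₁ hφ₁ hd₁) (d₁.toRelTopFrob.obj A₁) hA₁).res
                  (galoisChartRel φ₁ hφ₁ d₁.relTop (d₁.relTop_base_eq φ₁ hφ₁ hd₁) (d₁.toRelTopFrob.obj A₁) hA₁).res_smul
                  ((galoisChartRel φ₁ hφ₁ d₁.relTop (d₁.relTop_base_eq φ₁ hφ₁ hd₁) (d₁.toRelTopFrob.obj A₁)
                    hA₁).muModel M hμ₁)))
              ((contextOfObjectAbs φ₂ hφ₂ d₂ hd₂ (Ψ.functor.obj A₁) hA₂ H₂ hH₂).dualityIsoOfLocalDuality M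
                ((e.isoFN M).symm.trans eFN₁) ((e.isNHSaturated_iff M).mp hc₁)
                (cupDualH_bijective_ofGalois_mlf p₂ (objL φ₂ hφ₂ d₂.relTop (d₂.toRelTopFrob.obj (Ψ.functor.obj A₁))) H₂ hH₂
                  (galoisChartRel φ₂ hφ₂ d₂.relTop (d₂.relTop_base_eq φ₂ hφ₂ hd₂) (d₂.toRelTopFrob.obj (Ψ.functor.obj A₁))
                    hA₂).res
                  (galoisChartRel φ₂ hφ₂ d₂.relTop (d₂.relTop_base_eq φ₂ hφ₂ hd₂) (d₂.toRelTopFrob.obj (Ψ.functor.obj A₁))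
                    hA₂).res_smul
                  ((galoisChartRel φ₂ hφ₂ d₂.relTop (d₂.relTop_base_eq φ₂ hφ₂ hd₂)
                    (d₂.toRelTopFrob.obj (Ψ.functor.obj A₁)) hA₂).muModel M hμ₂)))) ∧
          -- Theorem 2.4 (ii) for `e`, modulo the `μ_N`-square
          ((∀ ζ : Kummer.Mu M (ObjMonoid d₁.relTop (d₁.toRelTopFrob.obj A₁)),
              ((((galoisChartRel φ₂ hφ₂ d₂.relTop (d₂.relTop_base_eq φ₂ hφ₂ hd₂)
                  (d₂.toRelTopFrob.obj (Ψ.functor.obj A₁)) hA₂).muModel M hμ₂).toMulEquiv (e.muIso M ζ) :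
                  rootsOfUnity M (AlgebraicClosure (baseFld p₂ φ₂ hφ₂))) : (AlgebraicClosure (baseFld p₂ φ₂ hφ₂))ˣ) =
                ψbar ((((galoisChartRel φ₁ hφ₁ d₁.relTop (d₁.relTop_base_eq φ₁ hφ₁ hd₁) (d₁.toRelTopFrob.obj A₁)
                  hA₁).muModel M hμ₁).toMulEquiv ζ : rootsOfUnity M (AlgebraicClosure (baseFld p₁ φ₁ hφ₁))) :
                    (AlgebraicClosure (baseFld p₁ φ₁ hφ₁))ˣ)) →
            ∃ (invE₁ : galoisCohomology (mu E₁ M) 2 →+ ZMod M) (invE₂ : galoisCohomology (mu E₂ M) 2 →+ ZMod M)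
              (inv₁ : FNInvariant (contextOfObjectAbs φ₁ hφ₁ d₁ hd₁ A₁ hA₁ H₁ hH₁) M)
              (inv₂ : FNInvariant (contextOfObjectAbs φ₂ hφ₂ d₂ hd₂ (Ψ.functor.obj A₁) hA₂ H₂ hH₂) M),
              Prop121vii.IsInvariantMap E₁ M invE₁ ∧ Prop121vii.IsInvariantMap E₂ M invE₂ ∧
              (∀ x, inv₁.toAddEquiv x = invE₁ (fnLayerMap (objL φ₁ hφ₁ d₁.relTop (d₁.toRelTopFrob.obj A₁)) H₁ hH₁
                (galoisChartRel φ₁ hφ₁ d₁.relTop (d₁.relTop_base_eq φ₁ hφ₁ hd₁) (d₁.toRelTopFrob.obj A₁) hA₁).res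
                (galoisChartRel φ₁ hφ₁ d₁.relTop (d₁.relTop_base_eq φ₁ hφ₁ hd₁) (d₁.toRelTopFrob.obj A₁) hA₁).res_smul
                E₁ hHE₁ ((galoisChartRel φ₁ hφ₁ d₁.relTop (d₁.relTop_base_eq φ₁ hφ₁ hd₁) (d₁.toRelTopFrob.obj A₁)
                  hA₁).muModel M hμ₁) x)) ∧
              (∀ x, inv₂.toAddEquiv x = invE₂ (fnLayerMap (objL φ₂ hφ₂ d₂.relTop (d₂.toRelTopFrob.obj (Ψ.functor.obj A₁)))
                H₂ hH₂
                (galoisChartRel φ₂ hφ₂ d₂.relTop (d₂.relTop_base_eq φ₂ hφ₂ hd₂) (d₂.toRelTopFrob.obj (Ψ.functor.obj A₁))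
                  hA₂).res
                (galoisChartRel φ₂ hφ₂ d₂.relTop (d₂.relTop_base_eq φ₂ hφ₂ hd₂) (d₂.toRelTopFrob.obj (Ψ.functor.obj A₁))
                  hA₂).res_smul
                E₂ hHE₂ ((galoisChartRel φ₂ hφ₂ d₂.relTop (d₂.relTop_base_eq φ₂ hφ₂ hd₂)
                  (d₂.toRelTopFrob.obj (Ψ.functor.obj A₁)) hA₂).muModel M hμ₂) x)) ∧
              Thm24ii (contextOfObjectAbs φ₁ hφ₁ d₁ hd₁ A₁ hA₁ H₁ hH₁)
                (contextOfObjectAbs φ₂ hφ₂ d₂ hd₂ (Ψ.functor.obj A₁) hA₂ H₂ hH₂) M fs₁ fs₂ (e.thm24Data M) inv₁ inv₂) := by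
  letI := PadicAlgCl.subfieldValuativeRel (baseFld p₁ φ₁ hφ₁)
  letI := PadicAlgCl.subfieldValuativeRel (baseFld p₂ φ₂ hφ₂)
  haveI := finiteDimensional_baseFld p₁ φ₁ hφ₁; haveI := finiteDimensional_baseFld p₂ φ₂ hφ₂
  haveI := PadicAlgCl.isNonarchimedeanLocalField_subfield (baseFld p₁ φ₁ hφ₁)
  haveI := PadicAlgCl.isNonarchimedeanLocalField_subfield (baseFld p₂ φ₂ hφ₂)
  haveI : CharZero (baseFld p₁ φ₁ hφ₁) := charZero_of_injective_algebraMap (algebraMap ℚ_[p₁] (baseFld p₁ φ₁ hφ₁)).injective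
  haveI : CharZero (baseFld p₂ φ₂ hφ₂) := charZero_of_injective_algebraMap (algebraMap ℚ_[p₂] (baseFld p₂ φ₂ hφ₂)).injective
  haveI := finiteDimensional_objL φ₁ hφ₁ d₁.relTop (d₁.toRelTopFrob.obj A₁)
  haveI := normal_objL φ₁ hφ₁ d₁.relTop (d₁.toRelTopFrob.obj A₁) hA₁
  haveI := finiteDimensional_objL φ₂ hφ₂ d₂.relTop (d₂.toRelTopFrob.obj (Ψ.functor.obj A₁))
  haveI := normal_objL φ₂ hφ₂ d₂.relTop (d₂.toRelTopFrob.obj (Ψ.functor.obj A₁)) hA₂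
  -- the same two instances in the syntactic form `Ψ♭ A₁♭` (definitionally `(Ψ A₁)♭`) used by the Kummer-side lemmas
  haveI : FiniteDimensional (baseFld p₂ φ₂ hφ₂)
      (objL φ₂ hφ₂ d₂.relTop ((relTopEquivalence Ψ).functor.obj (d₁.toRelTopFrob.obj A₁))) :=
    finiteDimensional_objL φ₂ hφ₂ d₂.relTop _
  haveI : Normal (baseFld p₂ φ₂ hφ₂) (objL φ₂ hφ₂ d₂.relTop ((relTopEquivalence Ψ).functor.obj (d₁.toRelTopFrob.obj A₁))) :=
    normal_objL φ₂ hφ₂ d₂.relTop _ hA₂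
  haveI := locallyCompactSpace_H_contextOfObjectRel φ₁ hφ₁ d₁.relTop (d₁.relTop_base_eq φ₁ hφ₁ hd₁)
    (d₁.toRelTopFrob.obj A₁) hA₁ H₁ hH₁
  haveI := locallyCompactSpace_H_contextOfObjectRel φ₂ hφ₂ d₂.relTop (d₂.relTop_base_eq φ₂ hφ₂ hd₂)
    (d₂.toRelTopFrob.obj (Ψ.functor.obj A₁)) hA₂ H₂ hH₂
  letI := (galoisChartRel φ₁ hφ₁ d₁.relTop (d₁.relTop_base_eq φ₁ hφ₁ hd₁) (d₁.toRelTopFrob.obj A₁) hA₁).galAction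
  letI := (galoisChartRel φ₂ hφ₂ d₂.relTop (d₂.relTop_base_eq φ₂ hφ₂ hd₂)
    (d₂.toRelTopFrob.obj (Ψ.functor.obj A₁)) hA₂).galAction
  letI := (galoisChartRel φ₂ hφ₂ d₂.relTop (d₂.relTop_base_eq φ₂ hφ₂ hd₂)
    ((relTopEquivalence Ψ).functor.obj (d₁.toRelTopFrob.obj A₁)) hA₂).galAction
  haveI := hasColimitsOfShape_nat_commMonCat.{0}
  -- (`obtain`/`cases` is avoided below: with this goal it exhausts the elaborator; we peel existentials with `Exists.elim`)
  -- a cofinal tower of open normal subgroups of `Π₁`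
  refine (exists_antitone_cofinal_seq hP₁).elim fun N hN' => ?_
  have hN := hN'.1; have hNb := hN'.2
  -- abc-iut-w5-d229's witnesses, ONE run, straightening kept (piece P4)
  refine (exists_rep_basePt_seq φ₁ hφ₁ N).elim fun x₁ hx₁ => ?_
  refine (exists_pairIso_fbarUnits_straightened hP₁ hP₂ φ₁ hφ₁ φ₂ hφ₂ N hN d₁ d₂ hd₁ hd₂ hfs₁ hfs₂ E ΨB hNb x₁ hx₁).elim
    fun φ h => h.elim fun ψ h => h.elim fun N₂ h => h.elim fun hN₂ h => h.elim fun hN₂b h => h.elim fun _ h => h.elim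
    fun ι h => h.elim fun ec h => h.elim fun x₂ h => h.elim fun _ h => h.elim fun ι₁ h => h.elim fun ι₂ h => h.elim
    fun ψbar h => ?_
  have hker := h.1; have hψ := h.2.1; have hstr := h.2.2.1; have hlw := h.2.2.2.2.1; have hleg₁ := h.2.2.2.2.2.1
  have hleg₂ := h.2.2.2.2.2.2.1; have hfac := h.2.2.2.2.2.2.2.1; have hσ := h.2.2.2.2.2.2.2.2.2
  -- `εF` at `θ := φ` (piece P3)
  refine (exists_basePushIso_relTop hP₁ hP₂ Ψ E η N hN hNb N₂ hN₂ hN₂b ι φ.toMulEquiv hstr).elim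
    fun hφo h' => h'.elim fun _ h' => h'.elim fun εF _ => ?_
  -- orientation (abc-iut-L1-d3's `hpos_of_equivalence`) and the [AbsAnab] chart pair
  have hpos := fun (k : ℕ) (b : d₁.B.obj (op (cQ (N k)))) (c : d₁.Φ.obj (op (cQ (N k))))
    (hbc : Frobenioids.divB d₁.Φ d₁.B d₁.divB (op (cQ (N k))) b = Algebra.GrothendieckGroup.of c) =>
    PadicFrd.Datum.hpos_of_equivalence hP₁ hZ₁ hP₂ hZ₂ Ψ E.functor η ΨB hΨB (cQ (N k)) b c hbc
  have hint := norm_psibar_le_one_of_levelwise φ₁ hφ₁ φ₂ hφ₂ N hN d₁ d₂ hd₁ hd₂ hfs₁ E ΨB hNb hpos N₂ hN₂ ι ec x₁ x₂ ι₁ ι₂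
    ψbar hlw hleg₁ hleg₂ hfac
  refine (exists_absAnabChart_of_integral φ₁ hφ₁ φ₂ hφ₂ (valuation_le_one_iff_norm_le_one_subfield _)
    (valuation_le_one_iff_norm_le_one_subfield _) ψ ψbar hσ hint).elim fun α h'' => h''.elim fun ψn h'' => ?_
  have hα := h''.1; have heq := h''.2.2.1; have hu := h''.2.2.2.1; have hunif := h''.2.2.2.2
  -- the Kummer side AT `θ := φ`: "`Ψ` preserves `O^▷`" ([FrdI] Thm. 3.4 (iv), PROVED), `hkerθ`, the representative `β`
  have hO := PadicFrd.map_mem_endSubmonoid_iff hP₁ hZ₁ hP₂ hZ₂ (relTopEquivalence Ψ)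
  have hkerθ : ∀ x : P₁, φ₁ x = 1 ↔ φ₂ (φ.toMulEquiv.toMonoidHom x) = 1 := ker_iff_of_map_ker_eq φ₁ φ₂ φ.toMulEquiv hker
  let e₀ := baseIsoOfPush (relTopEquivalence Ψ).functor φ.toMulEquiv.toMonoidHom hφo εF (d₁.toRelTopFrob.obj A₁)
  let δ : absoluteGaloisGroup (baseFld p₂ φ₂ hφ₂) :=
    (galConjBase p₂ φ₂ hφ₂).symm (toIm φ₂ hφ₂ (baseRep (relTopEquivalence Ψ).functor φ.toMulEquiv.toMonoidHom hφo e₀))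
  let β := isoGOfTheta φ₁ hφ₁ φ₂ hφ₂ (relTopEquivalence Ψ).functor φ.toMulEquiv.toMonoidHom φ.continuous hφo φ.surjective
    hkerθ e₀
  have hψθ : ∀ g : P₁, (ψ ⟨φ₁ g, ⟨g, rfl⟩⟩ : GalFbar ℚ_[p₂]) = φ₂ (φ.toMulEquiv.toMonoidHom g) := hψ
  -- `isoG = Inn(δ⁻¹) ∘ α` (gen 7), so `δ⁻¹ • ψ̄♮` is THE units transport for `isoG`
  have hβψ : Prop121vii.IsAlphaEquivariant β (ψn.trans (MulDistribMulAction.toMulEquiv _ δ⁻¹)) :=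
    isAlphaEquivariant_isoGOfTheta_innerTwist φ₁ hφ₁ φ₂ hφ₂ _ _ φ.continuous hφo φ.surjective hkerθ e₀ ψ hψθ α hα heq
  have hβu : Prop121vii.PreservesAbsUnits (ψn.trans (MulDistribMulAction.toMulEquiv _ δ⁻¹)) := hu.innerTwist _
  have hβunif : Prop121vii.PreservesUniformizers (ψn.trans (MulDistribMulAction.toMulEquiv _ δ⁻¹)) := hunif.innerTwist _
  refine ⟨β, ψn.trans (MulDistribMulAction.toMulEquiv _ δ⁻¹), hβψ, hβu, hβunif, fun map_H => ?_⟩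
  -- THE `Ψ`-induced context isomorphism at `θ := φ` (gen 6's `isoOfFunctorRelBasePush`)
  let e := isoOfFunctorRelBasePush (d₁.relTop_base_eq φ₁ hφ₁ hd₁) (d₂.relTop_base_eq φ₂ hφ₂ hd₂) (relTopEquivalence Ψ).functor
    (A₁ := d₁.toRelTopFrob.obj A₁) hA₁ hA₂ (hO _) φ.toMulEquiv.toMonoidHom φ.continuous hφo φ.surjective hkerθ εF
    (hH₁ := hH₁) (hH₂ := hH₂) map_H
  have heG : e.isoG = β := rfl
  refine ⟨e, heG, fun a => rfl, fun hfs eFN₁ => ?_, fun hsq => ?_⟩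
  · -- Theorem 2.4 (i) for `e` (gen 6)
    exact thm24i_ofFunctorRel_ofBasePush (d₁.relTop_base_eq φ₁ hφ₁ hd₁) (d₂.relTop_base_eq φ₂ hφ₂ hd₂)
      (relTopEquivalence Ψ).functor (A₁ := d₁.toRelTopFrob.obj A₁) hA₁ hA₂ (hO _) φ.toMulEquiv.toMonoidHom φ.continuous
      hφo φ.surjective hkerθ εF map_H M hμ₁ hμ₂ fs₁ fs₂ hfs eFN₁ hc₁
  · -- Theorem 2.4 (ii) for `e` (abc-iut-w5-d201 / L2-t12's closer), from the `μ_N`-square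
    have hc₂ : IsNHSaturated (contextOfObjectAbs φ₂ hφ₂ d₂ hd₂ (Ψ.functor.obj A₁) hA₂ H₂ hH₂) M :=
      (e.isNHSaturated_iff M).mp hc₁
    exact Def22Context.Iso.exists_thm24ii_ofGalois e M
      ((galoisChartRel φ₁ hφ₁ d₁.relTop (d₁.relTop_base_eq φ₁ hφ₁ hd₁) (d₁.toRelTopFrob.obj A₁) hA₁).muModel M hμ₁)
      ((galoisChartRel φ₂ hφ₂ d₂.relTop (d₂.relTop_base_eq φ₂ hφ₂ hd₂) (d₂.toRelTopFrob.obj (Ψ.functor.obj A₁))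
        hA₂).muModel M hμ₂)
      E₁ hHE₁ E₂ hHE₂ hc₁ hc₂ _ hβψ hβu hβunif hsq fs₁ fs₂

end PadicKummer.Def22Context

end Literature.AlgebraicGeometry.Frobenioids

end
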